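import Summits.Ventures.HSemireg.Pad4TowerLineMoments
import Summits.Ventures.HSemireg.PhaseTorusLawProof
import Summits.Ventures.HSemireg.PhaseTorusLaw7

/-!
# Phase-torus law at DESIGN level, cokernel orientation: a clean two-term LINE design of corank ≤ 4 (≤ 7) has `μ = 0`
# (HSemireg support file `Pad4TowerLinePhaseTorus`, third of three; «control» lens g5, LINE for idea-crit-6, 2026-08-29)

Sequel of `Pad4TowerLineLetters` (§1 LINE letters, §1a letter calculus, §1c census glue), `Pad4TowerLineMoments`
(§1b slot calculus, §2 (M) `topMoment_eq_zero_of_classScreen`, §3 flows `UpFlow`∕`DownFlow`, §4 DOWN law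
`lineTwoTermDown_mu_eq_zero`) and of `PhaseTorusLaw` ∕ `PhaseTorusLawProof` ∕ `PhaseTorusLaw7` (the finite harmonic-analysis
law `phaseTorusLaw_holds`, `phaseTorusLaw7_holds`). THIS FILE = the transport (T)+(ω) of the memo
`Cruxes/BlochSeedDiscOne/PHASE-TORUS-LAW-g5.md` §2 and the UP-orientation law: §4b the residual phase measure of an UP flow
(`phaseOf`, `tau`, `toComplex_betaG`, `wordOf`, `toComplex_mono_wordOf`, `tau_eq_of_le`), §4b′
`lineTwoTermUp_mu_eq_zero_of_law γ` (given the torus-form law for positive sets of size ≤ γ, an (A1)-clean LINE design with a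
P-saturating UP flow of corank ≤ γ has `C.wch mN mP eWord = 0`), its instances `lineTwoTermUp_mu_eq_zero` (γ = 4) and
`lineTwoTermUp7_mu_eq_zero` (γ = 7) with the law as a hypothesis, and the DISCHARGED forms `lineTwoTermUp_mu_eq_zero_holds`,
`lineTwoTermUp7_mu_eq_zero_holds` (by `PhaseTorus.phaseTorusLaw_holds` ∕ `phaseTorusLaw7_holds`).
Bytes of record of the crux-dir form: `Cruxes/BlochSeedDiscOne/LinePhaseTorus.lean` 7bccd0589afd5c59 (statements control g5; §4b
and the UP body s4-prove-1 g32; §4b′∕§4c control g5).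
WHAT THIS IS: kernel arithmetic about ONE presentation class (integer two-term LINE designs in the 𝔅(μ₄) frame); everything
PROVED (axioms `propext`, `Classical.choice`, `Quot.sound`), no `sorry`, no named fact, no instance, no notation.
WHAT IT IS NOT: anything about monads (C3ᴹ), the semi-homogeneous alphabet, a SOURCE or a SEED; nothing here proves HC,
HC_AV, HC_CM, H2 or item 18881; census-neutral.
-/

namespace Summit.Ventures.HSemireg.LinePhaseTorus

open Finset BigOperators Summit.Ventures.HSemireg Summit.Ventures.HSemireg.Pad4Tower

/-! ## §4b UP orientation — transport to the phase torus (s4-prove-1 g32; `e s = i^s` and its calculus are `PhaseTorus.e*` of `PhaseTorusLaw.lean`) -/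

/-- phase index of a factor point off the apex (`0` at the apex, where it is immaterial). -/
def phaseOf (p : BPoint) : Fin 4 :=
  if 0 < p.2.1 then 0 else if p.2.2 < 0 then 1 else if p.2.1 < 0 then 2 else if 0 < p.2.2 then 3 else 0

/-- `phaseOf` recovers the phase index of a LINE letter off the apex (`c > 0`). -/
theorem phaseOf_lineLetter (h : ℤ) {c : ℕ} (hc : 0 < c) (k : Fin 4) : phaseOf (lineLetter h c k) = k := by
  have hc' : (0 : ℤ) < c := by exact_mod_cast hc
  have hc0 : c ≠ 0 := hc.ne'
  fin_cases k <;> simp [phaseOf, lineLetter, hc0, not_lt.mpr hc'.le]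

/-- the torus coordinate of a cell: `τ_f = −k_f` (so that the character `(1,1,1,1)` reads the `ββββ` moment). -/
def tau (Z : MCell) : Fin 4 → ZMod 4 := fun f => -(((phaseOf (Z f)).val : ℕ) : ZMod 4)

/-- the negated phase exponents `−k` for `k = 0,1,2,3` have `val` `0,3,2,1`. -/
theorem neg_val_table (k : Fin 4) : (-(((k.val : ℕ)) : ZMod 4)).val = ![0, 3, 2, 1] k := by
  fin_cases k <;> decide

/-- `conj(i^k)` as a complex number is `i^{−k}`. -/
theorem toComplex_unitG (k : Fin 4) : ((unitG k : GaussianInt) : ℂ) = PhaseTorus.e (-((k.val : ℕ) : ZMod 4)) := by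
  rw [PhaseTorus.e, neg_val_table]
  fin_cases k <;> simp [unitG, GaussianInt.toComplex_def₂, Complex.ext_iff, pow_succ, Complex.I_mul_I]

/-- `β_f` in `ℂ` is `c_f · e(τ_f)`. -/
theorem toComplex_betaG {h : ℤ} {Z : MCell} (hZ : LineCell h Z) (f : Fin 4) :
    ((betaG Z f : GaussianInt) : ℂ) = (lineCharge h Z f : ℂ) * PhaseTorus.e (tau Z f) := by
  obtain ⟨c, k, e⟩ := hZ f
  rw [betaG_of_eq e, lineCharge_of_eq e, map_mul, map_natCast, toComplex_unitG]
  push_cast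
  rcases Nat.eq_zero_or_pos c with h0 | hpos
  · simp [h0]
  · congr 1
    simp only [tau, e, phaseOf_lineLetter h hpos k]

/-- `β̄_f` in `ℂ` is `c_f · e(3 τ_f)`. -/
theorem toComplex_star_betaG {h : ℤ} {Z : MCell} (hZ : LineCell h Z) (f : Fin 4) :
    ((star (betaG Z f) : GaussianInt) : ℂ) = (lineCharge h Z f : ℂ) * PhaseTorus.e (3 * tau Z f) := by
  rw [GaussianInt.toComplex_star, toComplex_betaG hZ f, map_mul, map_intCast, PhaseTorus.e_three_mul]

/-- the moment word read by the character `k` (entries `0,1,3 ↦ c, β, β̄`; `2 ↦` unit, never used). -/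
def wordOf (k : Fin 4 → ZMod 4) : Fin 4 → Fin 4 :=
  fun f => if k f = 0 then 1 else if k f = 1 then 2 else if k f = 3 then 3 else 0

/-- Literal facts in `ℤ/4` used to evaluate `wordOf`. -/
theorem z4_facts : (1 : ZMod 4) ≠ 0 ∧ (2 : ZMod 4) ≠ 0 ∧ (2 : ZMod 4) ≠ 1 ∧ (2 : ZMod 4) ≠ 3 ∧
    (3 : ZMod 4) ≠ 0 ∧ (3 : ZMod 4) ≠ 1 := by decide

/-- `k_f = 0` reads the letter `c` (index `1`). -/
theorem wordOf_apply_zero {k : Fin 4 → ZMod 4} {f : Fin 4} (h : k f = 0) : wordOf k f = 1 := by simp [wordOf, h]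
/-- `k_f = 1` reads the letter `β` (index `2`). -/
theorem wordOf_apply_one {k : Fin 4 → ZMod 4} {f : Fin 4} (h : k f = 1) : wordOf k f = 2 := by
  simp [wordOf, h, z4_facts.1]
/-- `k_f = 3` reads the letter `β̄` (index `3`). -/
theorem wordOf_apply_three {k : Fin 4 → ZMod 4} {f : Fin 4} (h : k f = 3) : wordOf k f = 3 := by
  simp [wordOf, h, z4_facts.2.2.2.2.1, z4_facts.2.2.2.2.2]

/-- The character `(1,1,1,1)` reads the word `ββββ`. -/
theorem wordOf_one : wordOf (fun _ => (1 : ZMod 4)) = fun _ => 2 := by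
  funext f; exact wordOf_apply_one rfl

/-- A character without `2`-entries reads a TOP word (no unit letter). -/
theorem wordOf_top {k : Fin 4 → ZMod 4} (hk : ∀ f, k f ≠ 2) : TopWord (wordOf k) := by
  intro f
  have h4 : ∀ y : ZMod 4, y = 0 ∨ y = 1 ∨ y = 2 ∨ y = 3 := by decide
  rcases h4 (k f) with h | h | h | h
  · rw [wordOf_apply_zero h]; decide
  · rw [wordOf_apply_one h]; decide
  · exact absurd h (hk f)
  · rw [wordOf_apply_three h]; decide

/-- `wordOf k = ββββ` only for `k = (1,1,1,1)`, `= β̄β̄β̄β̄` only for `k = (3,3,3,3)` (characters without `2`-entries). -/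
theorem wordOf_ne {k : Fin 4 → ZMod 4} (hk2 : ∀ f, k f ≠ 2) {j : ZMod 4} {m : Fin 4} (hj : j = 1 ∧ m = 2 ∨ j = 3 ∧ m = 3)
    (hk : k ≠ fun _ => j) : wordOf k ≠ fun _ => m := by
  intro h
  apply hk
  funext f
  have hf := congr_fun h f
  have h4 : ∀ y : ZMod 4, y = 0 ∨ y = 1 ∨ y = 2 ∨ y = 3 := by decide
  rcases h4 (k f) with e | e | e | e
  · rw [wordOf_apply_zero e] at hf; rcases hj with ⟨-, rfl⟩ | ⟨-, rfl⟩ <;> exact absurd hf (by decide)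
  · rw [wordOf_apply_one e] at hf; rcases hj with ⟨rfl, -⟩ | ⟨-, rfl⟩
    · exact e
    · exact absurd hf (by decide)
  · exact absurd e (hk2 f)
  · rw [wordOf_apply_three e] at hf; rcases hj with ⟨-, rfl⟩ | ⟨rfl, -⟩
    · exact absurd hf (by decide)
    · exact e

/-- per factor: the moment letter read by `k_f ∈ {0,1,3}` is `c_f · e(k_f τ_f)` in `ℂ`. -/
theorem toComplex_mletter_wordOf {h : ℤ} {Z : MCell} (hZ : LineCell h Z) (k : Fin 4 → ZMod 4) (f : Fin 4)
    (hk : k f ≠ 2) :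
    ((mletter h Z f (wordOf k f) : GaussianInt) : ℂ) = (lineCharge h Z f : ℂ) * PhaseTorus.e (k f * tau Z f) := by
  have h4 : ∀ y : ZMod 4, y = 0 ∨ y = 1 ∨ y = 2 ∨ y = 3 := by decide
  rcases h4 (k f) with e | e | e | e
  · rw [wordOf_apply_zero e, e, zero_mul, PhaseTorus.e_zero, mul_one]
    simp [mletter]
  · rw [wordOf_apply_one e, e, one_mul]
    simp only [mletter, Matrix.cons_val_two, Matrix.tail_cons, Matrix.head_cons]
    exact toComplex_betaG hZ f
  · exact absurd e hk
  · rw [wordOf_apply_three e, e]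
    simp only [mletter, Matrix.cons_val_three, Matrix.tail_cons, Matrix.head_cons]
    exact toComplex_star_betaG hZ f

/-- the monomial of a cell at the word read by `k` is `V(Z) · χ_k(τ(Z))` in `ℂ`. -/
theorem toComplex_mono_wordOf {h : ℤ} {Z : MCell} (hZ : LineCell h Z) (k : Fin 4 → ZMod 4) (hk : ∀ f, k f ≠ 2) :
    ((MCell.mono h Z (wordOf k) : GaussianInt) : ℂ) =
      ((∏ f, lineCharge h Z f : ℤ) : ℂ) * Complex.I ^ (∑ f, k f * tau Z f).val := by
  unfold MCell.mono
  rw [map_prod, Finset.prod_congr rfl fun f _ => toComplex_mletter_wordOf hZ k f (hk f), Finset.prod_mul_distrib]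
  push_cast
  congr 1
  exact (PhaseTorus.e_sum _).symm

/-- phases agree along a live pair off the apex locus: `P ≤ N`, `V(N) ≠ 0 ⇒ τ(N) = τ(P)`. -/
theorem tau_eq_of_le {h : ℤ} {P N : MCell} (hP : LineCell h P) (hN : LineCell h N) (hle : MCell.le P N)
    (hv : ∏ f, lineCharge h N f ≠ 0) : tau N = tau P := by
  funext f
  obtain ⟨c, k, e⟩ := hP f
  obtain ⟨c', k', e'⟩ := hN f
  have he : Effective (bsub (lineLetter h c' k') (lineLetter h c k)) := by
    have := hle f; rwa [e, e'] at this
  obtain ⟨hcc, hk⟩ := slide_letter h he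
  have hc' : c' ≠ 0 := by
    intro h0
    apply hv
    apply Finset.prod_eq_zero (Finset.mem_univ f)
    rw [lineCharge_of_eq e', h0]; rfl
  have hpos' : 0 < c' := Nat.pos_of_ne_zero hc'
  have hpos : 0 < c := lt_of_lt_of_le hpos' hcc
  rcases hk with h0 | hkk
  · exact absurd h0 hc'
  · subst hkk
    simp only [tau, e, e', phaseOf_lineLetter h hpos, phaseOf_lineLetter h hpos']


/-- **§4b′ the UP law for a general residual bound `γ`** (body = s4-prove-1 g32's K3c proof of memo §2 (T)+(ω)+(P), with the
literal corank bound `4` replaced by `γ`; control g5): given the torus-form law for positive sets of size `≤ γ`, an integer clean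
LINE design with a two-term cokernel presentation of corank `≤ γ` carries no Weil moment. -/
theorem lineTwoTermUp_mu_eq_zero_of_law (γ : ℕ)
    (hPT : ∀ (ω : (Fin 4 → ZMod 4) → ℝ) (A : Finset (Fin 4 → ZMod 4)), A.card ≤ γ →
      (∀ τ, τ ∉ A → ω τ ≤ 0) →
      (∀ k : Fin 4 → ZMod 4, ((∀ f, k f ≠ 2) ∧ k ≠ (fun _ => 1) ∧ k ≠ (fun _ => 3)) →
        (∑ τ : Fin 4 → ZMod 4, (ω τ : ℂ) * Complex.I ^ (∑ f, k f * τ f).val) = 0) →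
      (∑ τ : Fin 4 → ZMod 4, (ω τ : ℂ) * Complex.I ^ (∑ f, (1 : ZMod 4) * τ f).val) = 0)
    (h : ℤ) (C : MConfig) (mN mP : MCell → ℤ)
    (_hmN : ∀ Z, 0 ≤ mN Z) (_hmP : ∀ P, 0 ≤ mP P)
    (hline : ∀ Z ∈ C.lower ∪ C.upper, LineCell h Z) (hA1 : ClassScreen (C.wch mN mP))
    (F : UpFlow C mN mP) (hrank : (∑ Z ∈ C.lower, mN Z) - (∑ P ∈ C.upper, mP P) ≤ (γ : ℤ)) :
    C.wch mN mP eWord = 0 := by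
  classical
  have hL : ∀ Z ∈ C.lower, LineCell h Z := fun Z hZ => hline Z (Finset.mem_union_left _ hZ)
  have hU : ∀ P ∈ C.upper, LineCell h P := fun P hP => hline P (Finset.mem_union_right _ hP)
  set v : MCell → ℤ := fun Z => ∏ f, lineCharge h Z f with hv
  set r : MCell → ℤ := fun N => mN N - ∑ P ∈ C.upper, (F.π P N : ℤ) with hr
  have hr0 : ∀ N ∈ C.lower, 0 ≤ r N := fun N hN => sub_nonneg.mpr (F.cap N hN)
  -- (0) flow decomposition of any weighted difference (as in the DOWN proof, π transposed)
  have hdec : ∀ {R : Type} [CommRing R] (g : MCell → R),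
      (∑ Z ∈ C.lower, (mN Z : R) * g Z) - ∑ P ∈ C.upper, (mP P : R) * g P =
        ∑ N ∈ C.lower, ((r N : R) * g N + ∑ P ∈ C.upper, (F.π P N : R) * (g N - g P)) := by
    intro R _ g
    have hs : ∑ P ∈ C.upper, (mP P : R) * g P = ∑ P ∈ C.upper, ∑ N ∈ C.lower, (F.π P N : R) * g P := by
      refine Finset.sum_congr rfl fun P hP => ?_
      rw [← Finset.sum_mul]
      congr 1
      have := F.sat P hP
      rw [← this]; push_cast; rfl
    have hpt : ∀ N, (r N : R) * g N + ∑ P ∈ C.upper, (F.π P N : R) * (g N - g P) =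
        (mN N : R) * g N - ∑ P ∈ C.upper, (F.π P N : R) * g P := by
      intro N
      simp only [hr, mul_sub, Finset.sum_sub_distrib, ← Finset.sum_mul]
      push_cast
      ring
    rw [Finset.sum_congr rfl fun N _ => hpt N, Finset.sum_sub_distrib, hs, Finset.sum_comm]
  -- (1) total residual = corank ≤ γ
  have hsumr : ∑ N ∈ C.lower, r N = (∑ Z ∈ C.lower, mN Z) - ∑ P ∈ C.upper, mP P := by
    simp only [hr, Finset.sum_sub_distrib]
    rw [Finset.sum_comm]
    congr 1
    exact Finset.sum_congr rfl fun P hP => F.sat P hP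
  -- the torus data: residual phase measure ω and the positive set A
  set A : Finset (Fin 4 → ZMod 4) := (C.lower.filter fun N => 0 < r N).image tau with hA
  set ω : (Fin 4 → ZMod 4) → ℝ := fun τ =>
      (∑ N ∈ C.lower, if tau N = τ then ((r N * v N : ℤ) : ℝ) else 0) +
        ∑ P ∈ C.upper, if tau P = τ then ((∑ N ∈ C.lower, (F.π P N : ℤ) * (v N - v P) : ℤ) : ℝ) else 0 with hω
  -- (1') |A| ≤ γ
  have hcard : A.card ≤ γ := by
    have h1 : (A.card : ℤ) ≤ ((C.lower.filter fun N => 0 < r N).card : ℤ) := by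
      exact_mod_cast Finset.card_image_le
    have h2 : ((C.lower.filter fun N => 0 < r N).card : ℤ) ≤ ∑ N ∈ C.lower.filter (fun N => 0 < r N), r N := by
      rw [Finset.card_eq_sum_ones]; push_cast
      exact Finset.sum_le_sum fun N hN => by have := (Finset.mem_filter.mp hN).2; omega
    have h3 : ∑ N ∈ C.lower.filter (fun N => 0 < r N), r N ≤ ∑ N ∈ C.lower, r N :=
      Finset.sum_le_sum_of_subset_of_nonneg (Finset.filter_subset _ _) fun N hN _ => hr0 N hN
    have : (A.card : ℤ) ≤ (γ : ℤ) := by linarith [hsumr]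
    exact_mod_cast this
  -- (2) ω ≤ 0 off A
  have hneg : ∀ τ, τ ∉ A → ω τ ≤ 0 := by
    intro τ hτ
    have h1 : ∑ N ∈ C.lower, (if tau N = τ then ((r N * v N : ℤ) : ℝ) else 0) = 0 := by
      refine Finset.sum_eq_zero fun N hN => ?_
      by_cases ht : tau N = τ
      · rw [if_pos ht]
        have hrN : ¬ 0 < r N := fun hpos => hτ (by
          rw [hA]; exact Finset.mem_image.mpr ⟨N, Finset.mem_filter.mpr ⟨hN, hpos⟩, ht⟩)
        have : r N = 0 := le_antisymm (not_lt.mp hrN) (hr0 N hN)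
        rw [this, zero_mul]; push_cast; rfl
      · rw [if_neg ht]
    have h2 : ∑ P ∈ C.upper, (if tau P = τ then
        ((∑ N ∈ C.lower, (F.π P N : ℤ) * (v N - v P) : ℤ) : ℝ) else 0) ≤ 0 := by
      refine Finset.sum_nonpos fun P hP => ?_
      by_cases ht : tau P = τ
      · rw [if_pos ht]
        have : ∑ N ∈ C.lower, (F.π P N : ℤ) * (v N - v P) ≤ 0 := by
          refine Finset.sum_nonpos fun N hN => ?_
          by_cases h0 : F.π P N = 0
          · simp [h0]
          · obtain ⟨-, -, hle⟩ := F.live P N h0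
            exact mul_nonpos_iff.mpr (Or.inl ⟨by exact_mod_cast Nat.zero_le _,
              sub_nonpos.mpr (v_le (hU P hP) (hL N hN) hle)⟩)
        exact_mod_cast this
      · rw [if_neg ht]
    show (∑ N ∈ C.lower, if tau N = τ then ((r N * v N : ℤ) : ℝ) else 0) +
        ∑ P ∈ C.upper, (if tau P = τ then
          ((∑ N ∈ C.lower, (F.π P N : ℤ) * (v N - v P) : ℤ) : ℝ) else 0) ≤ 0
    rw [h1, zero_add]; exact h2
  -- (3) the moments of ω are the design moments
  have hmom : ∀ k : Fin 4 → ZMod 4, (∀ f, k f ≠ 2) →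
      (∑ τ : Fin 4 → ZMod 4, (ω τ : ℂ) * Complex.I ^ (∑ f, k f * τ f).val) =
        ((moment h C mN mP (wordOf k) : GaussianInt) : ℂ) := by
    intro k hk
    -- the character as a function of the cell
    set χ : (Fin 4 → ZMod 4) → ℂ := fun τ => Complex.I ^ (∑ f, k f * τ f).val with hχ
    -- left side: push the fibre sums through
    have hlhs : (∑ τ : Fin 4 → ZMod 4, (ω τ : ℂ) * χ τ) =
        ∑ N ∈ C.lower, ((r N * v N : ℤ) : ℂ) * χ (tau N) +
          ∑ P ∈ C.upper, ((∑ N ∈ C.lower, (F.π P N : ℤ) * (v N - v P) : ℤ) : ℂ) * χ (tau P) := by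
      have e1 : ∀ τ, (ω τ : ℂ) * χ τ =
          ∑ N ∈ C.lower, (if tau N = τ then ((r N * v N : ℤ) : ℂ) * χ τ else 0) +
            ∑ P ∈ C.upper, (if tau P = τ then
              ((∑ N ∈ C.lower, (F.π P N : ℤ) * (v N - v P) : ℤ) : ℂ) * χ τ else 0) := by
        intro τ
        rw [hω]; push_cast
        rw [add_mul, Finset.sum_mul, Finset.sum_mul]
        congr 1 <;> refine Finset.sum_congr rfl fun x _ => ?_ <;> split_ifs <;> simp
      rw [Finset.sum_congr rfl fun τ _ => e1 τ, Finset.sum_add_distrib, Finset.sum_comm,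
        Finset.sum_comm (s := Finset.univ) (t := C.upper)]
      congr 1 <;> refine Finset.sum_congr rfl fun x _ => ?_ <;> rw [Finset.sum_ite_eq] <;> simp
    -- right side: the design moment, decomposed along the flow
    have hg : ∀ Z, LineCell h Z → ((MCell.mono h Z (wordOf k) : GaussianInt) : ℂ) = (v Z : ℂ) * χ (tau Z) :=
      fun Z hZ => toComplex_mono_wordOf hZ k hk
    have hrhs : ((moment h C mN mP (wordOf k) : GaussianInt) : ℂ) =
        (∑ Z ∈ C.lower, (mN Z : ℂ) * ((v Z : ℂ) * χ (tau Z))) -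
          ∑ P ∈ C.upper, (mP P : ℂ) * ((v P : ℂ) * χ (tau P)) := by
      unfold moment
      rw [map_sub, map_sum, map_sum]
      congr 1
      · refine Finset.sum_congr rfl fun Z hZ => ?_
        rw [zsmul_eq_mul, map_mul, map_intCast, hg Z (hL Z hZ)]
      · refine Finset.sum_congr rfl fun P hP => ?_
        rw [zsmul_eq_mul, map_mul, map_intCast, hg P (hU P hP)]
    -- the transport step on each live pair
    have hpair : ∀ P ∈ C.upper, ∀ N ∈ C.lower,
        (F.π P N : ℂ) * ((v N : ℂ) * χ (tau N) - (v P : ℂ) * χ (tau P)) =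
          (F.π P N : ℂ) * ((v N : ℂ) - v P) * χ (tau P) := by
      intro P hP N hN
      by_cases h0 : F.π P N = 0
      · simp [h0]
      · obtain ⟨-, -, hle⟩ := F.live P N h0
        by_cases hvN : v N = 0
        · rw [hvN]; push_cast; ring
        · rw [tau_eq_of_le (hU P hP) (hL N hN) hle hvN]; ring
    rw [hlhs, hrhs, hdec (R := ℂ) (fun Z => (v Z : ℂ) * χ (tau Z)), Finset.sum_add_distrib]
    congr 1
    · refine Finset.sum_congr rfl fun N _ => ?_
      push_cast; ring
    · rw [Finset.sum_comm]
      refine Finset.sum_congr rfl fun P hP => ?_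
      push_cast
      rw [Finset.sum_mul]
      exact Finset.sum_congr rfl fun N hN => (hpair P hP N hN).symm
  -- (4) clean moments of ω vanish by (M); (5) the law kills ω̂(1,1,1,1) = μ
  have hclean : ∀ k : Fin 4 → ZMod 4, ((∀ f, k f ≠ 2) ∧ k ≠ (fun _ => 1) ∧ k ≠ (fun _ => 3)) →
      (∑ τ : Fin 4 → ZMod 4, (ω τ : ℂ) * Complex.I ^ (∑ f, k f * τ f).val) = 0 := by
    rintro k ⟨hk2, hk1, hk3⟩
    rw [hmom k hk2, topMoment_eq_zero_of_classScreen h C mN mP hline hA1 (wordOf k) (wordOf_top hk2)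
      (wordOf_ne hk2 (Or.inl ⟨rfl, rfl⟩) hk1) (wordOf_ne hk2 (Or.inr ⟨rfl, rfl⟩) hk3), map_zero]
  have htop := hPT ω A hcard hneg hclean
  rw [hmom (fun _ => 1) (fun _ => by decide), wordOf_one] at htop
  have hμ : moment h C mN mP (fun _ => 2) = 0 :=
    GaussianInt.toComplex_injective (by rw [htop, map_zero])
  rw [wch_eWord_eq_moment_beta h, hμ]

/-- **UP (cokernel orientation), rank ≤ 4**: a LINE configuration passing (A1) with a P-saturating up flow and
`Σ m_N − Σ m_P ≤ 4` has `μ = 0`, GIVEN the finite phase-torus law `hPT` (verbatim `PhaseTorus.PhaseTorusLaw`; discharged in §4d by `PhaseTorus.phaseTorusLaw_holds`). -/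
theorem lineTwoTermUp_mu_eq_zero
    (hPT : ∀ (ω : (Fin 4 → ZMod 4) → ℝ) (A : Finset (Fin 4 → ZMod 4)), A.card ≤ 4 →
      (∀ τ, τ ∉ A → ω τ ≤ 0) →
      (∀ k : Fin 4 → ZMod 4, ((∀ f, k f ≠ 2) ∧ k ≠ (fun _ => 1) ∧ k ≠ (fun _ => 3)) →
        (∑ τ : Fin 4 → ZMod 4, (ω τ : ℂ) * Complex.I ^ (∑ f, k f * τ f).val) = 0) →
      (∑ τ : Fin 4 → ZMod 4, (ω τ : ℂ) * Complex.I ^ (∑ f, (1 : ZMod 4) * τ f).val) = 0)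
    (h : ℤ) (C : MConfig) (mN mP : MCell → ℤ)
    (_hmN : ∀ Z, 0 ≤ mN Z) (_hmP : ∀ P, 0 ≤ mP P)
    (hline : ∀ Z ∈ C.lower ∪ C.upper, LineCell h Z) (hA1 : ClassScreen (C.wch mN mP))
    (F : UpFlow C mN mP) (hrank : (∑ Z ∈ C.lower, mN Z) - (∑ P ∈ C.upper, mP P) ≤ 4) :
    C.wch mN mP eWord = 0 :=
  lineTwoTermUp_mu_eq_zero_of_law 4 hPT h C mN mP _hmN _hmP hline hA1 F (by exact_mod_cast hrank)

/-- **§4c the UP law at corank ≤ 7** (control g5; PART E of `PhaseTorusLaw.lean` v4 = `phaseTorusLaw7_holds` discharges `hPT7`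
verbatim): the same sentence with `4 ↦ 7` — the sharp range of the box certificate (memo §9 (C⁷)). -/
theorem lineTwoTermUp7_mu_eq_zero
    (hPT7 : ∀ (ω : (Fin 4 → ZMod 4) → ℝ) (A : Finset (Fin 4 → ZMod 4)), A.card ≤ 7 →
      (∀ τ, τ ∉ A → ω τ ≤ 0) →
      (∀ k : Fin 4 → ZMod 4, ((∀ f, k f ≠ 2) ∧ k ≠ (fun _ => 1) ∧ k ≠ (fun _ => 3)) →
        (∑ τ : Fin 4 → ZMod 4, (ω τ : ℂ) * Complex.I ^ (∑ f, k f * τ f).val) = 0) →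
      (∑ τ : Fin 4 → ZMod 4, (ω τ : ℂ) * Complex.I ^ (∑ f, (1 : ZMod 4) * τ f).val) = 0)
    (h : ℤ) (C : MConfig) (mN mP : MCell → ℤ)
    (_hmN : ∀ Z, 0 ≤ mN Z) (_hmP : ∀ P, 0 ≤ mP P)
    (hline : ∀ Z ∈ C.lower ∪ C.upper, LineCell h Z) (hA1 : ClassScreen (C.wch mN mP))
    (F : UpFlow C mN mP) (hrank : (∑ Z ∈ C.lower, mN Z) - (∑ P ∈ C.upper, mP P) ≤ 7) :
    C.wch mN mP eWord = 0 :=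
  lineTwoTermUp_mu_eq_zero_of_law 7 hPT7 h C mN mP _hmN _hmP hline hA1 F (by exact_mod_cast hrank)

/-! ## §4d the law DISCHARGED (the torus-form laws are theorems of `PhaseTorusLawProof` ∕ `PhaseTorusLaw7`) -/

/-- **UP (cokernel orientation), corank ≤ 4 — unconditional**: an (A1)-clean LINE configuration with a P-saturating up flow and
`Σ m_N − Σ m_P ≤ 4` has `μ = C.wch mN mP eWord = 0` (`hPT` discharged by `PhaseTorus.phaseTorusLaw_holds`). -/
theorem lineTwoTermUp_mu_eq_zero_holds (h : ℤ) (C : MConfig) (mN mP : MCell → ℤ)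
    (hmN : ∀ Z, 0 ≤ mN Z) (hmP : ∀ P, 0 ≤ mP P)
    (hline : ∀ Z ∈ C.lower ∪ C.upper, LineCell h Z) (hA1 : ClassScreen (C.wch mN mP))
    (F : UpFlow C mN mP) (hrank : (∑ Z ∈ C.lower, mN Z) - (∑ P ∈ C.upper, mP P) ≤ 4) :
    C.wch mN mP eWord = 0 :=
  lineTwoTermUp_mu_eq_zero (fun ω A hA hω hK => PhaseTorus.phaseTorusLaw_holds ω A hA hω hK)
    h C mN mP hmN hmP hline hA1 F hrank

/-- **UP (cokernel orientation), corank ≤ 7 — unconditional** (`hPT7` discharged by `PhaseTorus.phaseTorusLaw7_holds`). -/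
theorem lineTwoTermUp7_mu_eq_zero_holds (h : ℤ) (C : MConfig) (mN mP : MCell → ℤ)
    (hmN : ∀ Z, 0 ≤ mN Z) (hmP : ∀ P, 0 ≤ mP P)
    (hline : ∀ Z ∈ C.lower ∪ C.upper, LineCell h Z) (hA1 : ClassScreen (C.wch mN mP))
    (F : UpFlow C mN mP) (hrank : (∑ Z ∈ C.lower, mN Z) - (∑ P ∈ C.upper, mP P) ≤ 7) :
    C.wch mN mP eWord = 0 :=
  lineTwoTermUp7_mu_eq_zero (fun ω A hA hω hK => PhaseTorus.phaseTorusLaw7_holds ω A hA hω hK)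
    h C mN mP hmN hmP hline hA1 F hrank

end Summit.Ventures.HSemireg.LinePhaseTorus
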